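import Literature.NumberTheory.Automorphic.IdeleClassCharacterAlgebraicTwist
import Literature.NumberTheory.Automorphic.IdeleClassGroupUnitMaps
import Literature.NumberTheory.GaloisRepresentations.CMTypeHeckeCharacter
import Literature.NumberTheory.GaloisRepresentations.HeckeCharacterProofs
import Literature.NumberTheory.GaloisRepresentations.HeckeCharacterInfinityTypeUnique
import HarnessLib

/-!
# `μ^{alg} ≠ (μ^{alg})^c · η` for conjugate symplectic `μ` and finite-order `η`
# (the infinity-type tie-break of [Liu2021, Thm. D.6 (1)])

Topic `NumberTheory/GaloisRepresentations`; namespace `Literature.NumberTheory.GaloisRepresentations`.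
A *proofs* file (theorems only; no definition, no named fact, no instance).

[Liu2021] App. D, proof of Thm. D.6 (1) (l. 5624–5630) puts `μ₁ := μ|·|_E^{−1/2} = μ^{alg}` and
`μ₂ := μᶜ χ̌ |·|_E^{−1/2} = (μ^{alg})^c · χ̌` (`χ̌` of finite order, trivial at infinity) and uses that
«`μ₁μ₂⁻¹` is not a Dirichlet character» / `μ̃_{τ₁}(z) = 1/z` vs `1/z̄`: the two candidates have DIFFERENT
infinity types.  In the tree's currency (`HeckeCharacter.HasInfinityType`, type `(p, q)` relative to the
distinguished embeddings `w.embedding`): for `μ : C_F →ₜ* S¹` conjugate symplectic with (odd) unitary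
∞-type `e` on the CM field `F`,
* `μ^{alg} = IdeleClassGroup.muAlg F μ` has type `((1 − e)/2, (1 + e)/2)`
  (`IsConjugateSymplectic.hasInfinityType_muAlg`);
* its conjugate `(μ^{alg})^c = HeckeCharacter.galConj c μ^{alg}` has the swapped type `((1 + e)/2, (1 − e)/2)`
  (`HeckeCharacter.HasInfinityType.galConj_complexConj`), and so does `(μ^{alg})^c · η` for every `η` of
  finite order (`IsFiniteOrder.hasInfinityType_zero`, `HasInfinityType.mul'`);
* by uniqueness of the type at a complex place (`HasInfinityType.eq_of_isComplex`,
  `HeckeCharacterInfinityTypeUnique`) equality would force `(1 − e_w)/2 = (1 + e_w)/2`, impossible for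
  odd `e_w`.

Main statement: `IdeleClassGroup.IsConjugateSymplectic.muAlg_ne_galConj_muAlg_mul`.  Consumer: step 4 of the
d6 line card (`Cruxes/HLiu418/Lines/d6_cm_curve`), where `μ₂ := galConj c (muAlg F μ) * χ̌` (A-plan2's S4
text of record, `χ̌` of finite order): the two candidate characters `μ₁ = muAlg F μ` and `μ₂` are distinct
and stay distinct under finite-order twists (print's «not a Dirichlet character»); the branch
`ψ_lab = μ₁` itself is then decided by the CM type of `ψ_lab` through
`HeckeCharacter.ne_of_hasInfinityType_ne_at_isComplex` (`HeckeCharacterInfinityTypeUnique`).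

## References
* Y. Liu, *Fourier–Jacobi cycles and arithmetic relative trace formula* (2021), App. D, proof of Thm. D.6 (1)
  (l. 5624–5630); §4.1 after Def. 4.3; Remark 4.4. [Liu2021]
* A. Weil, *On a certain type of characters of the idèle-class group of an algebraic number-field* (1956), §1. [Weil1956]
* J. Neukirch, *Algebraic Number Theory* (1999), Ch. VII §6 (6.9). [NeukirchANT1999]
-/

noncomputable section

open scoped NumberField
open NumberField NumberField.InfinitePlace Filter
open Literature.NumberTheory.Automorphic Literature.NumberTheory.Automorphic.IdeleClassGroup

namespace Literature.NumberTheory.GaloisRepresentations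

namespace HeckeCharacter

variable {K : Type} [Field K] [NumberField K]

/-- **A finite-order Hecke character has infinity type `(0, 0)`**: its kernel is a neighbourhood of `1`
(`ker_mem_nhds_of_isFiniteOrder`: the values lie in the discrete set of roots of unity), and `x ↦ (x, 1)` is
continuous, so `η((x, 1)) = 1 = A_{0,0}(x)` near `1` (Neukirch VII (6.9); light-import twin of the tree's
`EllipticCurves.hasInfinityType_zero_of_isFiniteOrder`). [cite: NeukirchANT1999, Ch. VII §6 Prop. (6.9)] -/
theorem IsFiniteOrder.hasInfinityType_zero {η : HeckeCharacter K} (hη : η.IsFiniteOrder) :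
    η.HasInfinityType (fun _ => 0) (fun _ => 0) := by
  refine ⟨infiniteIdeles K ⁻¹' {x : ideleGroup K | η x = 1}, ?_, fun x hx => ?_⟩
  · refine (continuous_infiniteIdeles K).continuousAt.preimage_mem_nhds ?_
    rw [map_one]
    exact ker_mem_nhds_of_isFiniteOrder hη
  · have h1 : η (infiniteIdeles K x) = 1 := hx
    rw [h1, Units.val_one, archFactor_apply]
    simp

end HeckeCharacter

end Literature.NumberTheory.GaloisRepresentations

namespace Literature.NumberTheory.Automorphic

open Literature.NumberTheory.GaloisRepresentations

section Twist

variable {F : Type} [Field F] [NumberField F] [IsCMField F]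

/-- **The conjugate of `μ^{alg}` has the swapped infinity type**: for `μ` conjugate symplectic with unitary
∞-type `e`, `HeckeCharacter.galConj c (muAlg F μ)` has type `((1 + e)/2, (1 − e)/2)`.
[cite: Liu2021, Remark 4.4; §4.1 after Def. 4.3 (l. 1922–1926)] -/
theorem IdeleClassGroup.IsConjugateSymplectic.hasInfinityType_galConj_muAlg
    {μ : IdeleClassGroup F →ₜ* Circle} (hμ : IsConjugateSymplectic F μ) :
    (HeckeCharacter.galConj (IsCMField.complexConj F) (muAlg F μ)).HasInfinityType
      (fun w => (1 + hμ.infinityType w) / 2) (fun w => (1 - hμ.infinityType w) / 2) :=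
  (hμ.hasInfinityType_muAlg hμ.hasInfinityType_infinityType).galConj_complexConj

/-- **`μ^{alg} ≠ (μ^{alg})^c · η` for every finite-order `η`** ([Liu2021] proof of Thm. D.6 (1), l. 5625:
«`μ₁μ₂⁻¹` is a Dirichlet character, which is not true», with `μ₁ = μ^{alg}`, `μ₂ = (μ^{alg})^c χ̌`, `χ̌` of
finite order): the types `((1−e)/2, (1+e)/2)` and `((1+e)/2, (1−e)/2)` of the two sides differ at every
(complex) place because `e` is odd, and a Hecke character has only one type at a complex place
(`HeckeCharacter.HasInfinityType.eq_of_isComplex`). [cite: Liu2021, Thm. D.6 (1) proof l. 5624–5630] [cite: Weil1956, §1] -/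
theorem IdeleClassGroup.IsConjugateSymplectic.muAlg_ne_galConj_muAlg_mul
    {μ : IdeleClassGroup F →ₜ* Circle} (hμ : IsConjugateSymplectic F μ)
    {η : HeckeCharacter F} (hη : η.IsFiniteOrder) :
    muAlg F μ ≠ HeckeCharacter.galConj (IsCMField.complexConj F) (muAlg F μ) * η := by
  intro heq
  have h1 := hμ.hasInfinityType_muAlg hμ.hasInfinityType_infinityType
  have h2 := hμ.hasInfinityType_galConj_muAlg.mul' (HeckeCharacter.IsFiniteOrder.hasInfinityType_zero hη)
  rw [← heq] at h2
  obtain ⟨w⟩ := (inferInstance : Nonempty (InfinitePlace F))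
  have hw : w.IsComplex := IsTotallyComplex.isComplex w
  obtain ⟨hp, -⟩ := h1.eq_of_isComplex h2 hw
  obtain ⟨k, hk⟩ := hμ.odd_infinityType w
  simp only [Pi.add_apply] at hp
  rw [hk] at hp
  omega

/-- The same with the twist on the other side: `μ^{alg} · η ≠ (μ^{alg})^c`. [cite: Liu2021, Thm. D.6 (1) proof l. 5624–5630] -/
theorem IdeleClassGroup.IsConjugateSymplectic.muAlg_mul_ne_galConj_muAlg
    {μ : IdeleClassGroup F →ₜ* Circle} (hμ : IsConjugateSymplectic F μ)
    {η : HeckeCharacter F} (hη : η.IsFiniteOrder) :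
    muAlg F μ * η ≠ HeckeCharacter.galConj (IsCMField.complexConj F) (muAlg F μ) := by
  intro heq
  apply hμ.muAlg_ne_galConj_muAlg_mul hη.inv
  rw [← heq, mul_assoc, mul_inv_cancel, mul_one]

/-- **In particular `μ^{alg} ≠ (μ^{alg})^c`** (`η = 1`). [cite: Liu2021, Thm. D.6 (1) proof l. 5624–5630] -/
theorem IdeleClassGroup.IsConjugateSymplectic.muAlg_ne_galConj_muAlg
    {μ : IdeleClassGroup F →ₜ* Circle} (hμ : IsConjugateSymplectic F μ) :
    muAlg F μ ≠ HeckeCharacter.galConj (IsCMField.complexConj F) (muAlg F μ) := by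
  have h := hμ.muAlg_ne_galConj_muAlg_mul (η := 1) IsOfFinOrder.one
  rwa [mul_one] at h

end Twist

end Literature.NumberTheory.Automorphic

end
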